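import Summits.AtomisticToContinuum.FouriersLaw.Theses.ContactEchoEpochs

/-!
# Line `birth` — birth-certificate skeleton (BC3) for the crux
`ContactEchoEpochs.PolynomialGapTail` (item stmt-AtomisticToContinuum-11820, crux rank 3 = window W3,
route `route-AtomisticToContinuum-ContactEchoEpochs`, sub-problem `FouriersLaw`)

Crux (FIXED, concluded BY NAME below). Notation: `P = pinnedChain ω₂ lam β γ` (all `> 0`), `T > 0`,
`N = n + 2`, `μ_T = P.gibbsMeasure N T`, `P_t = P.transitionKernel N T T t` (constructed Langevin kernels),
contact powers `w_L = γ(T − p_0²)`, `w_R = γ(T − p_{N−1}²)`, contact relaxation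
`g_N(t) := P_t w_R = z ↦ ∫ w_R dP_t(z, ·)` and contact echo `c_N(t) := ∫ w_L · g_N(t) dμ_T`.
`PolynomialGapTail`: `∃ a > 2`, for every `N` the echo is integrable on `(N^a, ∞)` and
`(N−1) T⁻² ∫_{(N^a,∞)} |c_N(t)| dt → 0`.

DECOMPOSITION = the route's own two-layer plan for W3 ("PolynomialGapTail ⇐ ContactGapBound"), typed,
with the functional-analytic reduction separated from the spectral input:

* `stub_contactRelaxation` (S1, HARDEST, size XL — the `ContactGapBound` of the route header): `L²(μ_T)` decay
  of the equilibrium contact relaxation with a POLYNOMIALLY TRACKED rate,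
  `‖P_t w_R‖²_{L²(μ_T)} ≤ (C N^m e^{−c t / N^b})²` for all `t ≥ 0` (some `m b : ℕ`, `C ≥ 0`, `c > 0`
  depending on the parameters and `T` only). `w_R` is `μ_T`-centred (`E p² = T`), so this is relaxation to
  equilibrium of ONE boundary observable; only a polynomial rate `N^{−b}` is asked (harmonic corner: `b = 3`,
  Becker–Menegaki 2022 Thm 1), so the catalogued gap-closing barriers (`BeckerMenegaki2022_gapClosing`,
  `equilibrium_rate_bound`: no `N`-UNIFORM rate) are respected, not fought. Expected proof shape: `N`-uniform
  Poincaré inequality for the log-concave `μ_T` (`Hess H_N ≥ min(1, ω₂)`, the grounder's "unused asset") +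
  hypocoercive transfer through the boundary-only dissipation (commutator chain of length `N` ⇒ polynomial loss).
  NOT the crux (pointwise-in-time operator statement, no time integral, no `a`) and does not follow from it.
* `stub_echoDomination` (S2, size M–L — semigroup functional analysis of the constructed kernels on `L²(μ_T)`):
  (i) `t ↦ c_N(t)` is measurable (joint measurability of `(t, z) ↦ P_t(z, ·)`,
  `LangevinChainSemigroup.measurable_kernel`, + measurability of parametric Bochner integrals); (ii) Cauchy–Schwarz
  domination with an `N`-UNIFORM constant, `|c_N(t)| ≤ K ‖P_t w_R‖_{L²(μ_T)}` for `t ≥ 0`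
  (`K = ‖w_L‖_{L²(μ_T)} = √2 γ T`: Gaussian momentum marginal of `μ_T`; needs `P_t w_R ∈ L²(μ_T)`, i.e.
  `μ_T`-invariance of the constructed kernels — `pinnedChain_isSteadyState_gibbsMeasure` + the PROVED item
  `NessUnique` — and Jensen for Markov kernels). NOT the crux (no decay at all) and does not imply it.
* `tail_of_envelope` — the real-analysis glue, FULLY PROVED (~70 lines): a measurable family `f_n` with
  `|f_n(t)| ≤ M N^m e^{−c t/N^b}` (`t ≥ 0`) is integrable on `(N^{b+3}, ∞)` and
  `(n+1) T⁻² ∫_{(N^{b+3},∞)} |f_n| ≤ (M/(cT²)) N^{m+b+1} e^{−cN} → 0`; the crux's `a` is `b + 3 > 2`.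
* `PolynomialGapTail_of : PolynomialGapTail` — S1 + S2 give the envelope with `M = K·C`, then `tail_of_envelope`;
  concluded BY NAME, the only `sorry`s are inside the two declared stubs.

Disproof.lean / dead lines / negatives: none exist for this crux at registration time (`ledger crux ls`:
no workfiles; `ledger negatives --problem AtomisticToContinuum`: no statement on contact relaxation / W3).
Both stubs keep the crux's binder prefix (`ω₂, lam, β, γ > 0`, `T > 0`); the harmonic member (`lam = β = 0`,
where S1 holds with `b = 3` and W3 is true while W2 fails) is outside their scope, as for the crux.
-/

namespace Summit.AtomisticToContinuum.FouriersLaw.Cruxes.PolynomialGapTail.Birth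

open MeasureTheory Filter Set Topology
open Summit.AtomisticToContinuum.FouriersLaw.Theses.ContactEchoEpochs (PolynomialGapTail)
open Literature.MathematicalPhysics.KineticTheory.HeatConduction (pinnedChain PhaseSpace)

/-! ## S1 — polynomially tracked `L²(μ_T)` contact relaxation (HARDEST) -/

/-- **S1 `stub_contactRelaxation`** (the route's `ContactGapBound`; spectral / hypocoercive input, XL).
For all parameters `> 0` and `T > 0` there are `m b : ℕ`, `C ≥ 0`, `c > 0` such that for every `N = n + 2`
and every `t ≥ 0`:
`∫ (P_t w_R)² dμ_T ≤ (C · N^m · exp(−c t / N^b))²`,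
i.e. `‖P_t w_R‖_{L²(μ_T)} ≤ C N^m e^{−ct/N^b}` — relaxation of the (centred) right contact power under the
equal-temperature constructed dynamics at a rate closing at most polynomially in `N`. -/
theorem stub_contactRelaxation :
    ∀ ω₂ lam β γ : ℝ, 0 < ω₂ → 0 < lam → 0 < β → 0 < γ → ∀ T : ℝ, 0 < T →
      ∃ (m b : ℕ) (C c : ℝ), 0 ≤ C ∧ 0 < c ∧ ∀ (n : ℕ) (t : ℝ), 0 ≤ t →
        ∫ z, (∫ y, γ * (T - (y.2 (Fin.last (n + 1))) ^ 2) ∂((pinnedChain ω₂ lam β γ).transitionKernel (n + 2) T T (Real.toNNReal t) z)) ^ 2 ∂((pinnedChain ω₂ lam β γ).gibbsMeasure (n + 2) T)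
          ≤ (C * ((n : ℝ) + 2) ^ m * Real.exp (-(c * t / ((n : ℝ) + 2) ^ b))) ^ 2 := by
  sorry

/-! ## S2 — the echo is measurable in time and dominated by the contact relaxation -/

/-- **S2 `stub_echoDomination`** (functional analysis of the constructed semigroup on `L²(μ_T)`, M–L).
For all parameters `> 0` and `T > 0` there is `K ≥ 0` (independent of `N` and `t`; in fact
`K = ‖w_L‖_{L²(μ_T)} = √2 γ T`) such that for every `N = n + 2`:
(i) the contact echo `t ↦ c_N(t) = ∫ w_L · (P_t w_R) dμ_T` is a measurable function of `t`, and
(ii) for every `t ≥ 0`, `|c_N(t)| ≤ K · √(∫ (P_t w_R)² dμ_T)` (Cauchy–Schwarz in `L²(μ_T)`, using that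
`P_t` preserves `L²(μ_T)` because `μ_T` is invariant for the equal-temperature kernels). -/
theorem stub_echoDomination :
    ∀ ω₂ lam β γ : ℝ, 0 < ω₂ → 0 < lam → 0 < β → 0 < γ → ∀ T : ℝ, 0 < T →
      ∃ K : ℝ, 0 ≤ K ∧ ∀ n : ℕ,
        Measurable (fun t : ℝ => ∫ z, γ * (T - (z.2 0) ^ 2) * (∫ y, γ * (T - (y.2 (Fin.last (n + 1))) ^ 2) ∂((pinnedChain ω₂ lam β γ).transitionKernel (n + 2) T T (Real.toNNReal t) z)) ∂((pinnedChain ω₂ lam β γ).gibbsMeasure (n + 2) T)) ∧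
        ∀ t : ℝ, 0 ≤ t →
          |∫ z, γ * (T - (z.2 0) ^ 2) * (∫ y, γ * (T - (y.2 (Fin.last (n + 1))) ^ 2) ∂((pinnedChain ω₂ lam β γ).transitionKernel (n + 2) T T (Real.toNNReal t) z)) ∂((pinnedChain ω₂ lam β γ).gibbsMeasure (n + 2) T)|
            ≤ K * Real.sqrt (∫ z, (∫ y, γ * (T - (y.2 (Fin.last (n + 1))) ^ 2) ∂((pinnedChain ω₂ lam β γ).transitionKernel (n + 2) T T (Real.toNNReal t) z)) ^ 2 ∂((pinnedChain ω₂ lam β γ).gibbsMeasure (n + 2) T)) := by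
  sorry

/-! ## The glue (real analysis, fully proved) -/

/-- Abstract glue: a measurable family `f n : ℝ → ℝ` with the polynomially tracked exponential envelope
`|f n t| ≤ M (n+2)^m exp(−c t/(n+2)^b)` for `t ≥ 0` is integrable on `((n+2)^(b+3), ∞)` and its rescaled tail
`(n+1) T⁻² ∫_{((n+2)^(b+3),∞)} |f n|` tends to `0`. The exponent `b + 3` is written as a real power, as in
the crux. -/
theorem tail_of_envelope (f : ℕ → ℝ → ℝ) {T : ℝ} (hT : 0 < T) (m b : ℕ) {M c : ℝ}
    (hM : 0 ≤ M) (hc : 0 < c) (hmeas : ∀ n, Measurable (f n))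
    (hbound : ∀ (n : ℕ) (t : ℝ), 0 ≤ t →
      |f n t| ≤ M * ((n : ℝ) + 2) ^ m * Real.exp (-(c * t / ((n : ℝ) + 2) ^ b))) :
    (∀ n : ℕ, IntegrableOn (f n) (Set.Ioi (((n : ℝ) + 2) ^ ((b : ℝ) + 3)))) ∧
      Tendsto (fun n : ℕ => ((n : ℝ) + 1) / T ^ 2 *
        ∫ t in Set.Ioi (((n : ℝ) + 2) ^ ((b : ℝ) + 3)), |f n t|) atTop (𝓝 0) := by
  have hN : ∀ n : ℕ, (0 : ℝ) < (n : ℝ) + 2 := fun n => by positivity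
  -- the real power `(n+2)^((b:ℝ)+3)` is the natural power `(n+2)^(b+3)`
  have hA : ∀ n : ℕ, ((n : ℝ) + 2) ^ ((b : ℝ) + 3) = ((n : ℝ) + 2) ^ (b + 3) := fun n => by
    rw [show ((b : ℝ) + 3) = ((b + 3 : ℕ) : ℝ) by push_cast; ring, Real.rpow_natCast]
  have hk : ∀ n : ℕ, 0 < c / ((n : ℝ) + 2) ^ b := fun n => by
    have := hN n
    positivity
  -- the envelope in the form `M N^m exp (-k t)`, `k = c / N^b`
  have henv : ∀ (n : ℕ) (t : ℝ), 0 ≤ t →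
      |f n t| ≤ M * ((n : ℝ) + 2) ^ m * Real.exp (-(c / ((n : ℝ) + 2) ^ b) * t) := by
    intro n t ht
    calc |f n t| ≤ M * ((n : ℝ) + 2) ^ m * Real.exp (-(c * t / ((n : ℝ) + 2) ^ b)) := hbound n t ht
      _ = M * ((n : ℝ) + 2) ^ m * Real.exp (-(c / ((n : ℝ) + 2) ^ b) * t) := by
          congr 2; ring
  -- the envelope is integrable on every half-line
  have hEint : ∀ (n : ℕ) (A : ℝ), IntegrableOn
      (fun t : ℝ => M * ((n : ℝ) + 2) ^ m * Real.exp (-(c / ((n : ℝ) + 2) ^ b) * t)) (Set.Ioi A) := by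
    intro n A
    exact (exp_neg_integrableOn_Ioi A (hk n)).const_mul (M * ((n : ℝ) + 2) ^ m)
  -- Part 1: integrability of `f n` on `(N^(b+3), ∞)` by domination
  have hInt : ∀ n : ℕ, IntegrableOn (f n) (Set.Ioi (((n : ℝ) + 2) ^ (b + 3))) := by
    intro n
    refine Integrable.mono' (hEint n _) (hmeas n).aestronglyMeasurable ?_
    refine ae_restrict_of_forall_mem measurableSet_Ioi fun t ht => ?_
    have ht0 : 0 ≤ t := le_of_lt (lt_trans (pow_pos (hN n) _) ht)
    rw [Real.norm_eq_abs]
    exact henv n t ht0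
  refine ⟨fun n => by rw [hA n]; exact hInt n, ?_⟩
  -- Part 2: the explicit tail bound `(n+1)/T² ∫_{Ioi N^(b+3)} |f n| ≤ (M/(cT²)) N^(m+b+1) e^{-cN}`
  simp only [hA]
  have hbnd : ∀ n : ℕ, ((n : ℝ) + 1) / T ^ 2 * ∫ t in Set.Ioi (((n : ℝ) + 2) ^ (b + 3)), |f n t|
      ≤ M / (c * T ^ 2) * (((n : ℝ) + 2) ^ (m + b + 1) * Real.exp (-(c * ((n : ℝ) + 2)))) := by
    intro n
    have hIntn := hInt n
    have hEn := hEint n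
    have henvn := henv n
    set N : ℝ := (n : ℝ) + 2 with hNdef
    have hNpos : 0 < N := hN n
    have hN0 : N ≠ 0 := hNpos.ne'
    have hN1 : 1 ≤ N := by rw [hNdef]; linarith [(Nat.cast_nonneg n : (0 : ℝ) ≤ n)]
    have hc0 : c ≠ 0 := hc.ne'
    have hT0 : T ≠ 0 := hT.ne'
    set k : ℝ := c / N ^ b with hkdef
    have hkpos : 0 < k := hk n
    set A : ℝ := N ^ (b + 3) with hAdef
    -- ∫ |f| ≤ ∫ envelope
    have h1 : ∫ t in Set.Ioi A, |f n t| ≤ ∫ t in Set.Ioi A, M * N ^ m * Real.exp (-k * t) := by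
      refine setIntegral_mono_on hIntn.integrable.abs (hEn A) measurableSet_Ioi fun t ht => ?_
      have ht0 : 0 ≤ t := le_of_lt (lt_trans (pow_pos hNpos _) ht)
      exact henvn t ht0
    -- evaluate the envelope integral
    have h2 : ∫ t in Set.Ioi A, M * N ^ m * Real.exp (-k * t)
        = M * N ^ m * (Real.exp (-k * A) / k) := by
      rw [integral_const_mul, integral_exp_mul_Ioi (neg_lt_zero.mpr hkpos) A, neg_div_neg_eq]
    have h3 : k * A = c * N ^ 3 := by
      rw [hkdef, hAdef]
      field_simp
      ring
    have h4 : Real.exp (-k * A) = Real.exp (-(c * N ^ 3)) := by rw [neg_mul, h3]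
    have h5 : Real.exp (-(c * N ^ 3)) ≤ Real.exp (-(c * N)) := by
      apply Real.exp_le_exp.mpr
      have hN2 : 1 ≤ N ^ 2 := one_le_pow₀ hN1
      have hNN : N ≤ N ^ 3 := by
        calc N = N * 1 := (mul_one N).symm
          _ ≤ N * N ^ 2 := by gcongr
          _ = N ^ 3 := by ring
      have hcN := mul_le_mul_of_nonneg_left hNN hc.le
      linarith
    have h6 : (n : ℝ) + 1 ≤ N := by rw [hNdef]; linarith
    calc ((n : ℝ) + 1) / T ^ 2 * ∫ t in Set.Ioi A, |f n t|
        ≤ ((n : ℝ) + 1) / T ^ 2 * (M * N ^ m * (Real.exp (-k * A) / k)) := by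
          apply mul_le_mul_of_nonneg_left (h1.trans_eq h2); positivity
      _ = M / (c * T ^ 2) * (((n : ℝ) + 1) * N ^ (m + b) * Real.exp (-(c * N ^ 3))) := by
          rw [h4, hkdef]
          field_simp
          ring
      _ ≤ M / (c * T ^ 2) * (N ^ (m + b + 1) * Real.exp (-(c * N))) := by
          apply mul_le_mul_of_nonneg_left _ (by positivity)
          calc ((n : ℝ) + 1) * N ^ (m + b) * Real.exp (-(c * N ^ 3))
              ≤ N * N ^ (m + b) * Real.exp (-(c * N)) := by gcongr
            _ = N ^ (m + b + 1) * Real.exp (-(c * N)) := by ring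
  -- the majorant tends to zero: polynomial times `exp (-c N)`
  have hlim : Tendsto (fun n : ℕ => M / (c * T ^ 2) *
      (((n : ℝ) + 2) ^ (m + b + 1) * Real.exp (-(c * ((n : ℝ) + 2))))) atTop (𝓝 0) := by
    have h0 : Tendsto (fun x : ℝ => x ^ (m + b + 1) * Real.exp (-(c * x))) atTop (𝓝 0) := by
      have h := tendsto_rpow_mul_exp_neg_mul_atTop_nhds_zero ((m + b + 1 : ℕ) : ℝ) c hc
      refine h.congr' ?_
      filter_upwards with x
      rw [Real.rpow_natCast, neg_mul]
    have h1 : Tendsto (fun n : ℕ => (n : ℝ) + 2) atTop atTop :=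
      tendsto_atTop_add_const_right atTop 2 tendsto_natCast_atTop_atTop
    have h2 := (h0.comp h1).const_mul (M / (c * T ^ 2))
    rw [mul_zero] at h2
    exact h2
  exact squeeze_zero (fun n => mul_nonneg (by positivity) (integral_nonneg fun t => abs_nonneg _)) hbnd hlim

/-! ## The skeleton theorem: the two stubs compose to the crux BY NAME -/

/-- **`PolynomialGapTail_of`** — S1 (`stub_contactRelaxation`) and S2 (`stub_echoDomination`) imply the crux
`PolynomialGapTail` (concluded by name; `a := b + 3`; the only `sorry`s are inside the two declared stubs). -/
theorem PolynomialGapTail_of : PolynomialGapTail := by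
  intro ω₂ lam β γ hω hl hβ hγ T hT
  obtain ⟨m, b, C, c, hC, hc, hrel⟩ := stub_contactRelaxation ω₂ lam β γ hω hl hβ hγ T hT
  obtain ⟨K, hK, hdom⟩ := stub_echoDomination ω₂ lam β γ hω hl hβ hγ T hT
  refine ⟨(b : ℝ) + 3, by have := (Nat.cast_nonneg b : (0 : ℝ) ≤ (b : ℝ)); linarith, ?_⟩
  refine tail_of_envelope
    (fun (n : ℕ) (t : ℝ) => ∫ z, γ * (T - (z.2 0) ^ 2) * (∫ y, γ * (T - (y.2 (Fin.last (n + 1))) ^ 2) ∂((pinnedChain ω₂ lam β γ).transitionKernel (n + 2) T T (Real.toNNReal t) z)) ∂((pinnedChain ω₂ lam β γ).gibbsMeasure (n + 2) T))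
    hT m b (mul_nonneg hK hC) hc (fun n => (hdom n).1) ?_
  intro n t ht
  have h1 := (hdom n).2 t ht
  have h2 := hrel n t ht
  have hE : 0 ≤ C * ((n : ℝ) + 2) ^ m * Real.exp (-(c * t / ((n : ℝ) + 2) ^ b)) := by positivity
  have h3 := (Real.sqrt_le_sqrt h2).trans_eq (Real.sqrt_sq hE)
  exact h1.trans ((mul_le_mul_of_nonneg_left h3 hK).trans_eq (by ring))

end Summit.AtomisticToContinuum.FouriersLaw.Cruxes.PolynomialGapTail.Birth
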